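import Summits.QuantumFields.YangMills.Theorems.BalabanLadderNTStrongCouplingMirrorClass
import HarnessLib

/-!
# Crux `NT` (stmt-QuantumFields-19353), strong-coupling rung 3: the LONG TUBE CLASSIFICATION — closed JOINED families of at
# most eighteen plaquettes of `ℤ⁴` through a plaquette at time `c` and a plaquette based at time `c - 4`

Helper file of the fleet lead prover of crux `NT` (unit `ym-spine-19353-p1`, g26).  HAND PROOF (no kernel search) of the
combinatorial input (H1′) of the free order-16 pair jet at height 2 (`stub_higherMirror_free_jet` of
`Cruxes/NT/Lines/slab_response_fh_rung3.lean`), one tube longer than g18's `…MirrorClass.eq_tube_of_closed` (budget 10):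

* `exists_temporal_of_chain` — a chain of bonds, consecutively adjacent through `F`, from a bond at time `≥ τ + 1` to a
  bond at time `≤ τ` passes through a TEMPORAL member of `F` based at time `τ` (the time of a bond `(z, μ)` is `z 0`; the
  bonds of a non-temporal plaquette all sit at its base time, those of a temporal one at base time and base time `+ 1`);
* `eq_longTube_of_closed` — a CLOSED family `F` (no private bond) of at most eighteen plaquettes containing `(x; a)` and a
  plaquette `pl` based at time `x 0 - 4`, in which a bond of `(x; a)` is JOINED to a bond of `pl` through `F`, is the
  eighteen-face boundary of the `4 × 1 × 1` box `[x 0 - 4, x 0] × (the unit square of (x; a))`: `a` is not temporal and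
  `F = {(x; a), (x - 4e₀; a)} ∪ {the sixteen temporal sides over the square at times x 0 - 1, …, x 0 - 4}`.

At budget 18 the joinedness hypothesis is NECESSARY (two unit cubes around far-apart plaquettes form a closed family of
twelve) — this is why the rung uses the connected leading-coefficient theorem
`Literature…StrongCouplingLeading.truncated_sub_leading_isBigO_multi_conn` (hypothesis (H1′)).

Proof: by the chain, the four slabs at times `x 0 - 4, …, x 0 - 1` are occupied, hence carry at least four temporal
members each (`four_le_card_slab_of_closed`); a fifth occupied slab would cost twenty (`four_mul_card_le_card`), so
`(x; a)` is not temporal and the slabs at `x 0` and `x 0 - 5` are empty; the near bonds of the lowest slab need a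
non-temporal member at time `x 0 - 4` (`near_cases`); counting `16 + 1 + 1 ≤ 18` the family is exactly the four slabs
(four members each), `(x; a)` and ONE non-temporal member at time `x 0 - 4`; then, top down, each slab consists of the
four sides over the square of `(x; a)` (`far_cases`, `mem_sides_of_far_mem`, `mem_four_of_add_mem`) and the bottom
member contains two parallel near bonds of the lowest sides (`eq_of_two_ilinks`).

HONEST FRAMING: lattice combinatorics only; nothing about measures, `β`, NT or the gap. [folklore]
-/

namespace Summit.QuantumFields.YangMills.Cruxes.NT.StrongCouplingRung.ClosedFamilies

open Finset
open Literature.Probability.LatticeModels (Site)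
open Literature.MathematicalPhysics.QuantumLattice (ZdEdge ZdPlaquette plaquetteEdges)
open Literature.MathematicalPhysics.QuantumFieldTheory (IsParallel LinkAdj mk_mem_plaquetteEdges_iff eq_of_two_ilinks
  add_single_ne_self four_mul_card_le_card)

/-! ### The time of a bond and the slab-crossing lemma -/

/-- **The time of a bond of a plaquette.**  A bond `(z, μ)` of the plaquette `(y; j, k)` has `z 0 = y 0`, or the
plaquette is temporal (`j = 0`) and `z 0 = y 0 + 1` (the far bond). [folklore] -/
theorem apply_zero_of_mem_plaquetteEdges {p : ZdPlaquette 4} {e : ZdEdge 4} (he : e ∈ plaquetteEdges p) :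
    e.1 0 = p.1 0 ∨ (p.2.1.1 = 0 ∧ e.1 0 = p.1 0 + 1) := by
  obtain ⟨y, ⟨⟨j, k⟩, hjk⟩⟩ := p
  obtain ⟨z, μ⟩ := e
  have hk : (0 : Fin 4) ≠ k := by
    intro h
    subst h
    exact absurd hjk (Fin.not_lt_zero _)
  rw [mk_mem_plaquetteEdges_iff] at he
  simp only at he ⊢
  rcases he with ⟨-, rfl | rfl⟩ | ⟨-, rfl | rfl⟩
  · exact Or.inl rfl
  · exact Or.inl (by simp [Pi.single_eq_of_ne hk])
  · by_cases hj : j = 0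
    · subst hj
      exact Or.inr ⟨rfl, by simp⟩
    · exact Or.inl (by simp [Pi.single_eq_of_ne (Ne.symm hj)])
  · exact Or.inl rfl

/-- **Slab crossing.**  If a bond at time `≥ τ + 1` is joined to a bond at time `≤ τ` by a chain of bonds consecutively
adjacent through `F`, then `F` has a temporal member based at time `τ`. [folklore] -/
theorem exists_temporal_of_chain {F : Finset (ZdPlaquette 4)} {e e' : ZdEdge 4}
    (h : Relation.ReflTransGen (LinkAdj F) e e') (τ : ℤ) (he : τ + 1 ≤ e.1 0) (he' : e'.1 0 ≤ τ) :
    ∃ p ∈ F, IsParallel p 0 ∧ p.1 0 = τ := by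
  induction h with
  | refl => exact absurd (he.trans he') (by omega)
  | @tail f g _ hfg ih =>
    by_cases hf : f.1 0 ≤ τ
    · exact ih hf
    · obtain ⟨p, hp, hfp, hgp⟩ := hfg
      rcases apply_zero_of_mem_plaquetteEdges hfp with h1 | ⟨hj, h1⟩ <;>
        rcases apply_zero_of_mem_plaquetteEdges hgp with h2 | ⟨hj', h2⟩
      · omega
      · omega
      · exact ⟨p, hp, (isParallel_zero_iff p).2 hj, by omega⟩
      · omega

/-- Monotonicity of link adjacency chains in the plaquette set. [folklore] -/
theorem reflTransGen_linkAdj_mono {X Y : Finset (ZdPlaquette 4)} (hXY : X ⊆ Y) {e e' : ZdEdge 4}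
    (h : Relation.ReflTransGen (LinkAdj X) e e') : Relation.ReflTransGen (LinkAdj Y) e e' := by
  induction h with
  | refl => exact Relation.ReflTransGen.refl
  | tail _ hbc ih =>
    obtain ⟨p, hp, h₁, h₂⟩ := hbc
    exact ih.tail ⟨p, hXY hp, h₁, h₂⟩

/-! ### The classification -/

/-- **Long tube classification.**  A closed family `F` of at most eighteen plaquettes of `ℤ⁴` containing a plaquette
`(x; a)` and a plaquette `pl` based at time `x 0 - 4`, some bond of `(x; a)` being joined to some bond of `pl` through
`F`, is the eighteen-face boundary of the `4 × 1 × 1` box under the square of `(x; a)`: `(x; a)` is not temporal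
(`0 < a₁`), and `F` consists of the sixteen temporal sides under the square of `(x; a)` at times `x 0 - 1, …, x 0 - 4`
and the two caps `(x; a)`, `(x - 4e₀; a)`. [folklore] -/
theorem eq_longTube_of_closed {F : Finset (ZdPlaquette 4)}
    (hN : ∀ p ∈ F, ∀ ℓ ∈ plaquetteEdges p, ∃ p' ∈ F, p' ≠ p ∧ ℓ ∈ plaquetteEdges p')
    (h18 : F.card ≤ 18) {x : Site 4} {a : {q : Fin 4 × Fin 4 // q.1 < q.2}} (hx : ((x, a) : ZdPlaquette 4) ∈ F)
    {pl : ZdPlaquette 4} (hpl : pl ∈ F) (hplc : pl.1 0 = x 0 - 4)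
    (hJ : ∃ e₁ ∈ plaquetteEdges ((x, a) : ZdPlaquette 4), ∃ e₂ ∈ plaquetteEdges pl,
      Relation.ReflTransGen (LinkAdj F) e₁ e₂) :
    ∃ ha : (0 : Fin 4) < a.1.1, F =
      {(x - Pi.single 0 1, ⟨(0, a.1.1), ha⟩), (x - Pi.single 0 1 + Pi.single a.1.2 1, ⟨(0, a.1.1), ha⟩),
        (x - Pi.single 0 1, ⟨(0, a.1.2), ha.trans a.2⟩),
        (x - Pi.single 0 1 + Pi.single a.1.1 1, ⟨(0, a.1.2), ha.trans a.2⟩),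
        (x - Pi.single 0 1 - Pi.single 0 1, ⟨(0, a.1.1), ha⟩),
        (x - Pi.single 0 1 + Pi.single a.1.2 1 - Pi.single 0 1, ⟨(0, a.1.1), ha⟩),
        (x - Pi.single 0 1 - Pi.single 0 1, ⟨(0, a.1.2), ha.trans a.2⟩),
        (x - Pi.single 0 1 + Pi.single a.1.1 1 - Pi.single 0 1, ⟨(0, a.1.2), ha.trans a.2⟩),
        (x - Pi.single 0 1 - Pi.single 0 1 - Pi.single 0 1, ⟨(0, a.1.1), ha⟩),
        (x - Pi.single 0 1 + Pi.single a.1.2 1 - Pi.single 0 1 - Pi.single 0 1, ⟨(0, a.1.1), ha⟩),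
        (x - Pi.single 0 1 - Pi.single 0 1 - Pi.single 0 1, ⟨(0, a.1.2), ha.trans a.2⟩),
        (x - Pi.single 0 1 + Pi.single a.1.1 1 - Pi.single 0 1 - Pi.single 0 1, ⟨(0, a.1.2), ha.trans a.2⟩),
        (x - Pi.single 0 1 - Pi.single 0 1 - Pi.single 0 1 - Pi.single 0 1, ⟨(0, a.1.1), ha⟩),
        (x - Pi.single 0 1 + Pi.single a.1.2 1 - Pi.single 0 1 - Pi.single 0 1 - Pi.single 0 1, ⟨(0, a.1.1), ha⟩),
        (x - Pi.single 0 1 - Pi.single 0 1 - Pi.single 0 1 - Pi.single 0 1, ⟨(0, a.1.2), ha.trans a.2⟩),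
        (x - Pi.single 0 1 + Pi.single a.1.1 1 - Pi.single 0 1 - Pi.single 0 1 - Pi.single 0 1,
          ⟨(0, a.1.2), ha.trans a.2⟩),
        (x, a), (x - Pi.single 0 1 - Pi.single 0 1 - Pi.single 0 1 - Pi.single 0 1, a)} := by
  obtain ⟨⟨a₁, a₂⟩, h₁₂⟩ := a
  obtain ⟨e₁, he₁, e₂, he₂, hchain⟩ := hJ
  have he₁0 : x 0 ≤ e₁.1 0 := by
    rcases apply_zero_of_mem_plaquetteEdges he₁ with h | ⟨-, h⟩
    · exact le_of_eq h.symm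
    · simp only at h; omega
  have he₂0 : e₂.1 0 ≤ x 0 - 3 := by
    rcases apply_zero_of_mem_plaquetteEdges he₂ with h | ⟨-, h⟩ <;> omega
  -- Step 1: the four slabs at times `x 0 - 1, …, x 0 - 4` are occupied (slab crossing along the chain)
  have hex1 : ∃ p ∈ F, IsParallel p 0 ∧ p.1 0 = x 0 - 1 :=
    exists_temporal_of_chain hchain _ (by omega) (by omega)
  have hex2 : ∃ p ∈ F, IsParallel p 0 ∧ p.1 0 = x 0 - 2 :=
    exists_temporal_of_chain hchain _ (by omega) (by omega)
  have hex3 : ∃ p ∈ F, IsParallel p 0 ∧ p.1 0 = x 0 - 3 :=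
    exists_temporal_of_chain hchain _ (by omega) (by omega)
  have hex4 : ∃ p ∈ F, IsParallel p 0 ∧ p.1 0 = x 0 - 4 := by
    by_cases hpar : IsParallel pl 0
    · exact ⟨pl, hpl, hpar, hplc⟩
    · rcases apply_zero_of_mem_plaquetteEdges he₂ with h2 | ⟨hj, -⟩
      · exact exists_temporal_of_chain hchain _ (by omega) (by omega)
      · exact absurd ((isParallel_zero_iff pl).2 hj) hpar
  have h4a := four_le_card_slab_of_closed hN 0 (x 0 - 1) hex1
  have h4b := four_le_card_slab_of_closed hN 0 (x 0 - 2) hex2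
  have h4c := four_le_card_slab_of_closed hN 0 (x 0 - 3) hex3
  have h4d := four_le_card_slab_of_closed hN 0 (x 0 - 4) hex4
  -- Step 2: no fifth occupied slab (it would cost twenty members)
  have hfive : ∀ t : ℤ, t ≠ x 0 - 1 → t ≠ x 0 - 2 → t ≠ x 0 - 3 → t ≠ x 0 - 4 →
      ∀ p ∈ F, IsParallel p 0 → p.1 0 ≠ t := by
    intro t h1 h2 h3 h4 p hp hpar hpt
    have h5 : ({x 0 - 1, x 0 - 2, x 0 - 3, x 0 - 4, t} : Finset ℤ).card = 5 := by
      rw [card_insert_of_notMem (by simp; omega), card_insert_of_notMem (by simp; omega),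
        card_insert_of_notMem (by simp; omega), card_insert_of_notMem (by simp; omega), card_singleton]
    have := four_mul_card_le_card F 0 {x 0 - 1, x 0 - 2, x 0 - 3, x 0 - 4, t} (by
      intro s hs
      simp only [mem_insert, mem_singleton] at hs
      rcases hs with rfl | rfl | rfl | rfl | rfl
      · exact h4a
      · exact h4b
      · exact h4c
      · exact h4d
      · exact four_le_card_slab_of_closed hN 0 _ ⟨p, hp, hpar, hpt⟩)
    omega
  have hT0 : ∀ p ∈ F, IsParallel p 0 → p.1 0 ≠ x 0 :=
    hfive (x 0) (by omega) (by omega) (by omega) (by omega)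
  have hT5 : ∀ p ∈ F, IsParallel p 0 → p.1 0 ≠ x 0 - 5 :=
    hfive (x 0 - 5) (by omega) (by omega) (by omega) (by omega)
  -- Step 3: the cap `(x; a)` is not temporal
  have hxa : ¬ IsParallel ((x, ⟨(a₁, a₂), h₁₂⟩) : ZdPlaquette 4) 0 := fun h => hT0 _ hx h rfl
  have ha : (0 : Fin 4) < a₁ := by
    rw [isParallel_zero_iff] at hxa
    exact Fin.pos_of_ne_zero hxa
  refine ⟨ha, ?_⟩
  -- Step 4: the six pieces and the count `4 + 4 + 4 + 4 + 1 + 1 ≤ 18`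
  set T1 := F.filter (fun p => IsParallel p 0 ∧ p.1 0 = x 0 - 1) with hT1
  set T2 := F.filter (fun p => IsParallel p 0 ∧ p.1 0 = x 0 - 2) with hT2
  set T3 := F.filter (fun p => IsParallel p 0 ∧ p.1 0 = x 0 - 3) with hT3
  set T4 := F.filter (fun p => IsParallel p 0 ∧ p.1 0 = x 0 - 4) with hT4
  set S0 := F.filter (fun p => ¬ IsParallel p 0 ∧ p.1 0 = x 0) with hS0
  set S4 := F.filter (fun p => ¬ IsParallel p 0 ∧ p.1 0 = x 0 - 4) with hS4
  have hxS0 : ((x, ⟨(a₁, a₂), h₁₂⟩) : ZdPlaquette 4) ∈ S0 := mem_filter.2 ⟨hx, hxa, rfl⟩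
  have hS4ne : S4.Nonempty := by
    obtain ⟨p, hp, hpar, hpc⟩ := hex4
    obtain ⟨y, ⟨⟨j, m⟩, hjm⟩⟩ := p
    rw [isParallel_zero_iff] at hpar
    simp only at hpar hpc
    subst hpar
    rcases near_cases hN hp with ⟨q, hq, hqpar, hq0, -⟩ | hq
    · exact ⟨q, mem_filter.2 ⟨hq, hqpar, by rw [hq0, hpc]⟩⟩
    · refine absurd ?_ (hT5 _ hq (Or.inl rfl))
      show (y - Pi.single 0 1 : Site 4) 0 = x 0 - 5
      simp [hpc]
      ring
  have djTT : ∀ (s t : ℤ), s ≠ t →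
      Disjoint (F.filter (fun p => IsParallel p 0 ∧ p.1 0 = s)) (F.filter (fun p => IsParallel p 0 ∧ p.1 0 = t)) :=
    fun s t hst => disjoint_filter.2 fun p _ h1 h2 => hst (h1.2.symm.trans h2.2)
  have djTS : ∀ (s t : ℤ),
      Disjoint (F.filter (fun p => IsParallel p 0 ∧ p.1 0 = s)) (F.filter (fun p => ¬ IsParallel p 0 ∧ p.1 0 = t)) :=
    fun s t => disjoint_filter.2 fun p _ h1 h2 => h2.1 h1.1
  have hU : T1 ∪ T2 ∪ T3 ∪ T4 ∪ S0 ∪ S4 ⊆ F :=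
    union_subset (union_subset (union_subset (union_subset (union_subset (filter_subset _ _) (filter_subset _ _))
      (filter_subset _ _)) (filter_subset _ _)) (filter_subset _ _)) (filter_subset _ _)
  have hcardU : (T1 ∪ T2 ∪ T3 ∪ T4 ∪ S0 ∪ S4).card =
      T1.card + T2.card + T3.card + T4.card + S0.card + S4.card := by
    rw [card_union_of_disjoint, card_union_of_disjoint, card_union_of_disjoint, card_union_of_disjoint,
      card_union_of_disjoint]
    · exact djTT _ _ (by omega)
    · rw [disjoint_union_left]
      exact ⟨djTT _ _ (by omega), djTT _ _ (by omega)⟩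
    · rw [disjoint_union_left, disjoint_union_left]
      exact ⟨⟨djTT _ _ (by omega), djTT _ _ (by omega)⟩, djTT _ _ (by omega)⟩
    · rw [disjoint_union_left, disjoint_union_left, disjoint_union_left]
      exact ⟨⟨⟨djTS _ _, djTS _ _⟩, djTS _ _⟩, djTS _ _⟩
    · rw [disjoint_union_left, disjoint_union_left, disjoint_union_left, disjoint_union_left]
      exact ⟨⟨⟨⟨djTS _ _, djTS _ _⟩, djTS _ _⟩, djTS _ _⟩, disjoint_filter.2 fun p _ h1 h2 => by omega⟩
  have hS0pos : 0 < S0.card := card_pos.2 ⟨_, hxS0⟩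
  have hS4pos : 0 < S4.card := card_pos.2 hS4ne
  have hFU : T1 ∪ T2 ∪ T3 ∪ T4 ∪ S0 ∪ S4 = F := eq_of_subset_of_card_le hU (by rw [hcardU]; omega)
  have hcards : T1.card = 4 ∧ T2.card = 4 ∧ T3.card = 4 ∧ T4.card = 4 ∧ S0.card = 1 ∧ S4.card = 1 := by
    have := card_le_card hU
    rw [hcardU] at this
    omega
  -- Step 5: `S0 = {(x; a)}`, `S4 = {qb}`, no non-temporal member at the intermediate times
  have hS0eq : S0 = {((x, ⟨(a₁, a₂), h₁₂⟩) : ZdPlaquette 4)} := by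
    obtain ⟨z, hz⟩ := card_eq_one.1 hcards.2.2.2.2.1
    rw [hz] at hxS0 ⊢
    rw [mem_singleton.1 hxS0]
  obtain ⟨qb, hS4eq⟩ := card_eq_one.1 hcards.2.2.2.2.2
  have hqb : qb ∈ S4 := by
    rw [hS4eq]
    exact mem_singleton_self _
  have hmemF : ∀ q ∈ F, q ∈ T1 ∨ q ∈ T2 ∨ q ∈ T3 ∨ q ∈ T4 ∨ q ∈ S0 ∨ q ∈ S4 := by
    intro q hq
    rw [← hFU] at hq
    simpa only [mem_union, or_assoc] using hq
  have hSmid : ∀ q ∈ F, ¬ IsParallel q 0 → q.1 0 ≠ x 0 - 1 ∧ q.1 0 ≠ x 0 - 2 ∧ q.1 0 ≠ x 0 - 3 := by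
    intro q hq hpar
    rcases hmemF q hq with h | h | h | h | h | h
    · exact absurd (mem_filter.1 h).2.1 hpar
    · exact absurd (mem_filter.1 h).2.1 hpar
    · exact absurd (mem_filter.1 h).2.1 hpar
    · exact absurd (mem_filter.1 h).2.1 hpar
    · have := (mem_filter.1 h).2.2
      omega
    · have := (mem_filter.1 h).2.2
      omega
  -- Step 6: the top slab consists of the four sides under the square of `(x; a)` (far bonds)
  have hT1eq : T1 = {(x - Pi.single 0 1, ⟨(0, a₁), ha⟩), (x - Pi.single 0 1 + Pi.single a₂ 1, ⟨(0, a₁), ha⟩),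
      (x - Pi.single 0 1, ⟨(0, a₂), ha.trans h₁₂⟩),
      (x - Pi.single 0 1 + Pi.single a₁ 1, ⟨(0, a₂), ha.trans h₁₂⟩)} := by
    refine eq_of_subset_of_card_le (fun p hp => ?_) (by rw [hcards.1]; exact card_le_four)
    obtain ⟨hpF, hpar, hpc⟩ := mem_filter.1 hp
    obtain ⟨y, ⟨⟨j, m⟩, hjm⟩⟩ := p
    rw [isParallel_zero_iff] at hpar
    simp only at hpar hpc
    subst hpar
    rcases far_cases hN hpF with ⟨q, hq, hqpar, hq0, hmem⟩ | hq
    · have hqS0 : q ∈ S0 := mem_filter.2 ⟨hq, hqpar, by rw [hq0, hpc]; ring⟩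
      rw [hS0eq, mem_singleton] at hqS0
      subst hqS0
      exact mem_sides_of_far_mem ha hmem
    · refine absurd ?_ (hT0 _ hq (Or.inl rfl))
      show (y + Pi.single 0 1 : Site 4) 0 = x 0
      simp [hpc]
  -- Step 7: each lower slab consists of the translates by `-e₀` of the slab above it (far bonds again)
  have hdown : ∀ (s : ℤ) {z₁ z₂ z₃ z₄ : Site 4} {o₁ o₂ o₃ o₄ : {q : Fin 4 × Fin 4 // q.1 < q.2}},
      (F.filter (fun p => IsParallel p 0 ∧ p.1 0 = s)) = {(z₁, o₁), (z₂, o₂), (z₃, o₃), (z₄, o₄)} →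
      (∀ q ∈ F, ¬ IsParallel q 0 → q.1 0 ≠ s) →
      (F.filter (fun p => IsParallel p 0 ∧ p.1 0 = s - 1)).card = 4 →
      (F.filter (fun p => IsParallel p 0 ∧ p.1 0 = s - 1)) =
        {(z₁ - Pi.single 0 1, o₁), (z₂ - Pi.single 0 1, o₂), (z₃ - Pi.single 0 1, o₃), (z₄ - Pi.single 0 1, o₄)} := by
    intro s z₁ z₂ z₃ z₄ o₁ o₂ o₃ o₄ hup hno hcard
    refine eq_of_subset_of_card_le (fun p hp => ?_) (by rw [hcard]; exact card_le_four)
    obtain ⟨hpF, hpar, hpc⟩ := mem_filter.1 hp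
    obtain ⟨y, ⟨⟨j, m⟩, hjm⟩⟩ := p
    rw [isParallel_zero_iff] at hpar
    simp only at hpar hpc
    subst hpar
    rcases far_cases hN hpF with ⟨q, hq, hqpar, hq0, -⟩ | hq
    · refine absurd ?_ (hno q hq hqpar)
      rw [hq0, hpc]
      ring
    · have hqup : ((y + Pi.single 0 1, ⟨(0, m), hjm⟩) : ZdPlaquette 4) ∈
          F.filter (fun p => IsParallel p 0 ∧ p.1 0 = s) :=
        mem_filter.2 ⟨hq, Or.inl rfl, by show (y + Pi.single 0 1 : Site 4) 0 = s; simp [hpc]⟩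
      rw [hup] at hqup
      exact mem_four_of_add_mem _ hqup
  have hT2eq := hdown (x 0 - 1) hT1eq (fun q hq hpar => (hSmid q hq hpar).1)
    (by rw [show x 0 - 1 - 1 = x 0 - 2 by ring]; exact hcards.2.1)
  rw [show x 0 - 1 - 1 = x 0 - 2 by ring] at hT2eq
  rw [← hT2] at hT2eq
  have hT3eq := hdown (x 0 - 2) hT2eq (fun q hq hpar => (hSmid q hq hpar).2.1)
    (by rw [show x 0 - 2 - 1 = x 0 - 3 by ring]; exact hcards.2.2.1)
  rw [show x 0 - 2 - 1 = x 0 - 3 by ring] at hT3eq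
  rw [← hT3] at hT3eq
  have hT4eq := hdown (x 0 - 3) hT3eq (fun q hq hpar => (hSmid q hq hpar).2.2)
    (by rw [show x 0 - 3 - 1 = x 0 - 4 by ring]; exact hcards.2.2.2.1)
  rw [show x 0 - 3 - 1 = x 0 - 4 by ring] at hT4eq
  rw [← hT4] at hT4eq
  -- Step 8: the bottom cap: `qb` contains two parallel near bonds of the lowest sides
  have hnear : ∀ (z : Site 4), ((z, ⟨(0, a₁), ha⟩) : ZdPlaquette 4) ∈ T4 →
      ((z, a₁) : ZdEdge 4) ∈ plaquetteEdges qb := by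
    intro z hz
    obtain ⟨hzF, -, hzc⟩ := mem_filter.1 hz
    simp only at hzc
    rcases near_cases hN hzF with ⟨q, hq, hqpar, hq0, hmem⟩ | hq
    · have hqS4 : q ∈ S4 := mem_filter.2 ⟨hq, hqpar, by rw [hq0, hzc]⟩
      rw [hS4eq, mem_singleton] at hqS4
      rw [← hqS4]
      exact hmem
    · refine absurd ?_ (hT5 _ hq (Or.inl rfl))
      show (z - Pi.single 0 1 : Site 4) 0 = x 0 - 5
      simp [hzc]
      ring
  have hz₁ : ((x - Pi.single 0 1 - Pi.single 0 1 - Pi.single 0 1 - Pi.single 0 1, ⟨(0, a₁), ha⟩) : ZdPlaquette 4) ∈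
      T4 := by
    rw [hT4eq]
    simp
  have hz₂ : ((x - Pi.single 0 1 + Pi.single a₂ 1 - Pi.single 0 1 - Pi.single 0 1 - Pi.single 0 1, ⟨(0, a₁), ha⟩) :
      ZdPlaquette 4) ∈ T4 := by
    rw [hT4eq]
    simp
  have hb₁ : ((x - Pi.single 0 1 - Pi.single 0 1 - Pi.single 0 1 - Pi.single 0 1, a₁) : ZdEdge 4) ∈
      plaquetteEdges ((x - Pi.single 0 1 - Pi.single 0 1 - Pi.single 0 1 - Pi.single 0 1, ⟨(a₁, a₂), h₁₂⟩) :
        ZdPlaquette 4) := by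
    rw [mk_mem_plaquetteEdges_iff]
    exact Or.inl ⟨rfl, Or.inl rfl⟩
  have hb₂ : ((x - Pi.single 0 1 + Pi.single a₂ 1 - Pi.single 0 1 - Pi.single 0 1 - Pi.single 0 1, a₁) : ZdEdge 4) ∈
      plaquetteEdges ((x - Pi.single 0 1 - Pi.single 0 1 - Pi.single 0 1 - Pi.single 0 1, ⟨(a₁, a₂), h₁₂⟩) :
        ZdPlaquette 4) := by
    rw [mk_mem_plaquetteEdges_iff]
    refine Or.inl ⟨rfl, Or.inr ?_⟩
    simp only
    abel
  have hneq : (x - Pi.single 0 1 - Pi.single 0 1 - Pi.single 0 1 - Pi.single 0 1 : Site 4) ≠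
      x - Pi.single 0 1 + Pi.single a₂ 1 - Pi.single 0 1 - Pi.single 0 1 - Pi.single 0 1 := by
    intro h
    have h' := congrFun h a₂
    have ha₂ : (a₂ : Fin 4) ≠ 0 := (ha.trans h₁₂).ne'
    simp [Pi.single_eq_of_ne ha₂] at h'
  have hcap : ((x - Pi.single 0 1 - Pi.single 0 1 - Pi.single 0 1 - Pi.single 0 1, ⟨(a₁, a₂), h₁₂⟩) :
      ZdPlaquette 4) = qb :=
    eq_of_two_ilinks hneq hb₁ hb₂ (hnear _ hz₁) (hnear _ hz₂)
  -- Step 9: assemble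
  rw [← hFU, hT1eq, hT2eq, hT3eq, hT4eq, hS0eq, hS4eq, ← hcap]
  simp only [insert_union, ← insert_eq]

end Summit.QuantumFields.YangMills.Cruxes.NT.StrongCouplingRung.ClosedFamilies
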